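import Mathlib
import HarnessLib

/-!
# Route `KLProgramme`, crux K3 `KLRegimeTwoPointLimit` — the COMBINATORIAL half of Lemma E.5 (peeling trichotomy):
# cut types by parity, and channel conservation along a bubble chain
# (DECOMP App. E, E2–E3, Lemma E.5; HOME/p1/E5-NOTE.md §4; cell gate-hubbard-kl, seat p1 = C1 `BetaSplit` lead)

A contribution to the 4-leg output `β⁴_j` of one scale is a connected graph whose vertices are even kernels (at an
endpoint: the running coupling `ψ⁺ψ⁻ψ⁺ψ⁻`).  Cut it into two connected sides `A | B` joined by `i ≥ 1` explicit lines,
with `e_A + e_B = 4` external legs distributed over the sides.  Every side has even total valence, so `e_A + i` and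
`e_B + i` are even.  `cut_classification` is the resulting finite case list — the local form of the trichotomy of
Lemma E.5 (E5-NOTE §4): `i ≥ 3` (OVERLAPPING: two-constraint sector gain), `i = 2 ∧ e_A = e_B = 2` (a BUBBLE cut:
particle–particle or particle–hole ladder step), `i = 2 ∧ {e_A, e_B} = {0, 4}` (a two-legged insertion) or
`i = 1 ∧ {e_A, e_B} = {1, 3}` (one-particle reducible leg dressing); the last two gain by the two-leg improvement of
Benfatto–Giuliani–Mastropietro 2006 §3.  For a bubble cut, charge conservation on side `A` (every vertex carries two
creation and two annihilation legs, every internal line pairs opposite charges, so the charges of the legs leaving `A`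
sum to zero) fixes the channel: equal external charges on `A` force equal charges on the two cut lines
(particle–particle), opposite external charges force opposite cut charges (particle–hole) — `bubbleCut_channel`.
Iterating along a chain of bubble cuts, the channel never changes — `chain_channel_pp`, `chain_channel_ph`: «mixed pp/ph
chains do not exist» (DECOMP App. E, E3 (α); Feldman–Knörrer–Trubowitz, *A two dimensional Fermi liquid 2*, CMP 247
(2004) §VII, Lemma on the pp/ph split of ladders).  Charges are modelled as integers `= ±1`; no graph theory is needed.
-/

namespace Summit.HubbardSuperconductivity.HubbardSuperconductivity.Theorems.LadderCutCombinatorics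

set_option linter.dupNamespace false -- summit = problem name (single-conjunct summit), D-0017

/-- **Cut types by parity.**  Two sides with `e_A + e_B = 4` external legs joined by `i ≥ 1` lines, both of even
valence: either `i ≥ 3` (overlapping), or a bubble cut `i = 2, e_A = e_B = 2`, or a two-legged insertion
`i = 2, {e_A, e_B} = {0,4}`, or a leg dressing `i = 1, {e_A, e_B} = {1,3}`. -/
theorem cut_classification (eA eB i : ℕ) (hsum : eA + eB = 4) (hi : 1 ≤ i)
    (hA : Even (eA + i)) (hB : Even (eB + i)) :
    3 ≤ i ∨ (i = 2 ∧ eA = 2 ∧ eB = 2) ∨ (i = 2 ∧ (eA = 0 ∧ eB = 4 ∨ eA = 4 ∧ eB = 0))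
      ∨ (i = 1 ∧ (eA = 1 ∧ eB = 3 ∨ eA = 3 ∧ eB = 1)) := by
  rw [Nat.even_iff] at hA hB
  omega

/-- The same list read for cuts with at most two lines: they are exactly the bubble cuts, the two-legged insertions
and the leg dressings (everything else is overlapping). -/
theorem cut_classification_of_le_two (eA eB i : ℕ) (hsum : eA + eB = 4) (hi : 1 ≤ i) (hi2 : i ≤ 2)
    (hA : Even (eA + i)) (hB : Even (eB + i)) :
    (i = 2 ∧ eA = 2 ∧ eB = 2) ∨ (i = 2 ∧ (eA = 0 ∧ eB = 4 ∨ eA = 4 ∧ eB = 0))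
      ∨ (i = 1 ∧ (eA = 1 ∧ eB = 3 ∨ eA = 3 ∧ eB = 1)) := by
  rw [Nat.even_iff] at hA hB
  omega

/-- A side whose externals are three of the four legs is joined to the rest by an ODD number of lines; with one line
it is a leg dressing, otherwise (`i ≥ 3`) it is overlapping — there is no bubble cut isolating a single external leg. -/
theorem no_bubble_cut_of_odd_externals (eA i : ℕ) (heA : eA = 1 ∨ eA = 3) (hA : Even (eA + i)) : i ≠ 2 := by
  rw [Nat.even_iff] at hA
  omega

/-- **Charge conservation across a bubble cut fixes the channel.**  Side `A` carries two external legs of charges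
`c₁, c₂` (`c₂ = ±1`) and the two cut lines leave it with charges `d₁, d₂ = ±1`; the charges leaving `A` sum to
zero.  Then equal external charges force `d₁ = d₂ = -c₁` (particle–particle cut), opposite external charges force
`d₁ = -d₂` (particle–hole cut). -/
theorem bubbleCut_channel (c₁ c₂ d₁ d₂ : ℤ) (hc₂ : c₂ = 1 ∨ c₂ = -1)
    (hd₁ : d₁ = 1 ∨ d₁ = -1) (hd₂ : d₂ = 1 ∨ d₂ = -1) (hsum : c₁ + c₂ + d₁ + d₂ = 0) :
    (c₁ = c₂ → d₁ = -c₁ ∧ d₂ = -c₁) ∧ (c₁ = -c₂ → d₁ = -d₂) := by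
  omega

/-- The two cases are exhaustive and exclusive for a bubble cut: the cut is particle–particle (`d₁ = d₂`) iff the
externals on that side have equal charge, and particle–hole (`d₁ = -d₂`) iff they have opposite charge. -/
theorem bubbleCut_pp_iff (c₁ c₂ d₁ d₂ : ℤ) (hc₁ : c₁ = 1 ∨ c₁ = -1) (hc₂ : c₂ = 1 ∨ c₂ = -1)
    (hd₁ : d₁ = 1 ∨ d₁ = -1) (hd₂ : d₂ = 1 ∨ d₂ = -1) (hsum : c₁ + c₂ + d₁ + d₂ = 0) :
    (d₁ = d₂ ↔ c₁ = c₂) ∧ (d₁ = -d₂ ↔ c₁ = -c₂) := by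
  omega

/-- **Channel conservation along a bubble chain (particle–particle).**  A chain of bubble cuts `k = 0, 1, …`: the two
lines of cut `k` leave the left vertex with charges `d k, d' k = ±1` and enter the next vertex with the opposite
charges; every intermediate vertex is a `ψ⁺ψ⁻ψ⁺ψ⁻` kernel, so its four charges `-d k, -d' k, d (k+1), d' (k+1)` sum
to zero.  If the first cut is particle–particle (`d 0 = d' 0`) then EVERY cut is particle–particle with the SAME
orientation: `d k = d' k = d 0`. -/
theorem chain_channel_pp (d d' : ℕ → ℤ) (L : ℕ)
    (hd : ∀ k, k < L → d k = 1 ∨ d k = -1) (hd' : ∀ k, k < L → d' k = 1 ∨ d' k = -1)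
    (hvertex : ∀ k, k + 1 < L → -d k + -d' k + d (k + 1) + d' (k + 1) = 0)
    (h0 : d 0 = d' 0) :
    ∀ k, k < L → d k = d 0 ∧ d' k = d 0 := by
  intro k
  induction k with
  | zero => intro _; exact ⟨rfl, h0.symm⟩
  | succ k ih =>
      intro hk
      have hkL : k < L := by omega
      obtain ⟨h1, h2⟩ := ih hkL
      have hv := hvertex k hk
      have := hd (k + 1) hk
      have := hd' (k + 1) hk
      have := hd k hkL
      omega

/-- **Channel conservation along a bubble chain (particle–hole).**  With the same bookkeeping, if the first cut is
particle–hole (`d 0 = -d' 0`) then every cut is particle–hole: `d k = -d' k`. -/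
theorem chain_channel_ph (d d' : ℕ → ℤ) (L : ℕ)
    (hd : ∀ k, k < L → d k = 1 ∨ d k = -1) (hd' : ∀ k, k < L → d' k = 1 ∨ d' k = -1)
    (hvertex : ∀ k, k + 1 < L → -d k + -d' k + d (k + 1) + d' (k + 1) = 0)
    (h0 : d 0 = -d' 0) :
    ∀ k, k < L → d k = -d' k := by
  intro k
  induction k with
  | zero => intro _; exact h0
  | succ k ih =>
      intro hk
      have hkL : k < L := by omega
      have h1 := ih hkL
      have hv := hvertex k hk
      have := hd (k + 1) hk
      have := hd' (k + 1) hk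
      omega

/-- Hence a chain that starts particle–particle never contains a particle–hole cut, and vice versa:
«mixed pp/ph chains do not exist» (DECOMP App. E, E3 (α)). -/
theorem chain_no_mixing (d d' : ℕ → ℤ) (L : ℕ)
    (hd : ∀ k, k < L → d k = 1 ∨ d k = -1) (hd' : ∀ k, k < L → d' k = 1 ∨ d' k = -1)
    (hvertex : ∀ k, k + 1 < L → -d k + -d' k + d (k + 1) + d' (k + 1) = 0) :
    (d 0 = d' 0 → ∀ k, k < L → d k ≠ -d' k) ∧ (d 0 = -d' 0 → ∀ k, k < L → d k ≠ d' k) := by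
  refine ⟨fun h0 k hk => ?_, fun h0 k hk => ?_⟩
  · obtain ⟨h1, h2⟩ := chain_channel_pp d d' L hd hd' hvertex h0 k hk
    have := hd k hk
    omega
  · have h1 := chain_channel_ph d d' L hd hd' hvertex h0 k hk
    have := hd k hk
    omega

/-- **Valence bookkeeping for the external endpoint** (E5-NOTE §4): an endpoint (`4` legs) carrying `e` of the four
external legs of `β⁴_j`, `t` spanning-tree lines and `m` loop lines has `e + t + m = 4`; in a graph with `n ≥ 2`
endpoints it is connected to the rest (`t ≥ 1`), so `e ≤ 3` and at most `3` of its lines are internal: the exact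
expansion of the Gram determinant along its loop fields terminates at order `m ≤ 3 - e` … precisely `m ≤ 4 - e - t`. -/
theorem endpoint_valence (e t m : ℕ) (h : e + t + m = 4) (ht : 1 ≤ t) (he : 1 ≤ e) :
    e ≤ 3 ∧ m ≤ 2 ∧ t + m ≤ 3 := by
  omega

end Summit.HubbardSuperconductivity.HubbardSuperconductivity.Theorems.LadderCutCombinatorics
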